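import Mathlib
import Summits.AnomalousDissipation.AnomalousDissipation.Theorems.IsotropicCubatureWord

/-!
# W7 / F-p4g13-1 — the THREE-MODE hypocoercivity functional for one slot on one Bloch fibre
(planner ad-ideate-p4 g13, lens «control»; input to the W7 designer p5 g9 and the `stub_highLabelDecay_IS` prover;
crux workfile of `LagrangianRenormalisationStep` (stmt-AnomalousDissipation-24912), companion memo `Lines/onelevel-W7-threemode.md`).

SETTING (cell problem of `HighLabelDecayW`, A = 0 Leray-projected passive vector, one slot `s` = layer
`a(t)·sin(2π m·x)·v̂/(2π|m|)` acting, viscosity symbol `D_K`).  On the Bloch fibre through `K₀ = k̃ q̂` the slot couples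
only along the chain `K_j = K₀ + j m`, `w_j := ŵ(K_j) ∈ range P_j` (`P_j` = Leray projector at `K_j`):
  `ẇ_j = −D_j w_j − ℓ(t) · P_j (w_{j−1} − w_{j+1})`,   `ℓ(t) = a(t)·(v̂·K₀)/(2|m|)·(2π·amplitude)` (a real scalar),
energy `E = Σ_j |w_j|²`, `Ė = −2 Σ_j ⟨D_j w_j, w_j⟩`.  Mode `j = 0` is SLOW (`‖D_0‖ = O(ν k̃²)`), modes `j ≠ 0` are FAST
(`D_j ≥ d_min ≍ 4π²ν(|m| − k̃)²·lo/Λ`).  In the polarisation frame `u ⊥ span{K₀,m}` (weights 1) / `e_j = K̂_j × u` (link weights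
`c_{j,j+1} = K̂_j·K̂_{j+1}`, `c_{0,±1} = (k̃ ± q̂·m)/|K₀ ± m|`) and for isotropic `D_j = d_j` the chain splits into two real scalar
chains `ẋ_j = −d_j x_j − l_{j−1,j} x_{j−1} + l_{j,j+1} x_{j+1}` — the object of the kernel certificate below.

THE FUNCTIONAL.  `Φ := E + ε·X`,  `X := ⟨w_0, b⟩`,  `b := ℓ·P_0(w_{+1} − w_{−1})` (= `ẇ_0 + D_0 w_0`, so `X = ½ d|w_0|²/dt + ⟨D_0w_0,w_0⟩`:
the cross term is the time-derivative of the slow energy).  `Ẋ` contains the coercive term `−ℓ²(|P_{+1}w_0|² + |P_{−1}w_0|²)`,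
which on the slow plane `w_0 = α u + β e_0` equals `−ℓ²(2α² + (c_{0,1}² + c_{−1,0}²) β²)`, i.e. `≍ −ℓ²·(1 − (p·m̂)²)|w_0|²` for
`w_0 = |w_0| p` — the SAME angular factor as the tree's `IsotropicCubatureWord.slotTerm`.  Every other term of `Ẋ` is a
slow×fast or fast×fast product and is paid by a quarter of the fast dissipation each (Young), under the κ-free / r-uniform choice
  `ε := min( d_min/(2ℓ_peak²·2) , d_min/(4 D_max²) )`     (`D_max ≥ ‖D_0‖ + ‖D_{±1}‖`),
giving the pointwise inequality (kernel-checked below for the scalar chain, theorem `threeMode_form_le`)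
  `Φ̇ ≤ −(ε Λ²/2)·x_0² − (3 d_min/2)(x_{+1}² + x_{−1}²) − d_2 (x_{+2}² + x_{−2}²) − 2 Σ_{|j|≥3} d_j x_j²`,  `Λ² = l_{0,1}² + l_{−1,0}²`,
hence, with `¾E ≤ Φ ≤ 5E/4` (theorem `threeMode_equiv`), the slow-mode DRAIN RATE
  `ρ ≥ (2/5)·ε Λ² = (2/5)·min( d_min/4·(Λ²/ℓ_peak²) , Λ² d_min/(4 D_max²) ) ≍ ν·|m|²·min(1, r²(v̂·q̂)²/C)·(1 − (p·m̂)²)`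
UNIFORMLY in `r = k̃/ν ∈ [1/Kb, ∞)` and in `ν` — no enhanced dissipation, no resolvent bound, no compactness in `r`.
RAMPED SLOT (`a(0) = a(τ) = 0`, `|ȧ| ≤ A₁`): `X` carries the factor `a(t)`, so `Φ = E` at both slot ends (NO norm-equivalence
prefactor per slot) and the ramp adds `ε ȧ ⟨w_0, b̂⟩`, paid by `d_min/2` of fast dissipation at the slow cost `ε²ȧ²Λ̂²/(2 d_min)·x_0²`
(theorem `ramp_term_le`): net slow drain `(ε Λ̂²/2)(a(t)² − ε ȧ(t)²/d_min) x_0²`; integrated over a triangle slot the correction is the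
factor `1 − 12ε/(d_min τ²) ≥ 1 − 3/(d_min τ)²` (add `ε ≤ d_min τ²/24` when `d_min τ < 3`).  PERIOD: every slot contracts the fibre energy by
`exp(−I_s)`, `I_s ≥ ∫ρ_s ≥ c·T_s·min over the slow plane`, and the minimum over polarisations of the angular factor is `(m̂_s·q̂)²`; the
cubature moments already in the tree (`Σ c_m (m̂·q)² = 140`, `Σ c_m (m̂·q)⁴ = 84` on `|q| = 1`) give `Σ_m c_m (m̂·q̂)²(1 − (m̂·q̂)²) = 56 > 0`
for EVERY fibre direction (theorem `doubleCoverage_sum` below, `ring` over the 13 directions): the per-period contraction is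
`φ² ≤ exp(−c·M·min(1, r²)) < 1`, `1 − φ² ≳ M/Kb²` — the (M′)/W7 rate `cK ∝ Kb⁻²` with explicit constants.

WHAT IS KERNEL-CHECKED HERE (reals only, no sorry): `xdot_identity` (Ẋ along the chain ODE is the polynomial used),
`threeMode_form_le` (the pointwise form inequality under the four constraints), `threeMode_equiv` (|εX| ≤ E/4-type equivalence),
`ramp_term_le` (the ramp Young step), `doubleCoverage_sum` (= 56|q|⁴).  WHAT IS NOT: the Fourier/fibre bookkeeping for weak solutions
(`PassiveVectorTensorPropagator*`, `stub_cellUnique`), the vector-valued (anisotropic `NearIso`/`OddSmall` window) version of the Young steps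
— same algebra with `|P_{±1} w_0|` in place of `x_0` and operator norms `‖D_j‖ ≤ D_max`, see the memo §5 and kit j316861 PART 3 — and Grönwall.
Numerics: kit j316861 (`threemode_check.py`): max-eigenvalue certificate ≤ 0 in all 54 steady cases (3 ν × 2 (q̂·m̂) × 9 k̃) and 12 anisotropic/odd
draws; ramped triangle slots: certified `exp(−∫ρ)` (ramp included) ≥ true worst-case contraction σ²_max in all 40 rows, exponent within a factor ≈ 8
of the truth in the Taylor regime, certified rate/ν ν-independent at fixed r (e.g. r = 5.66: 0.01221 (ν=10⁻³) vs 0.01248 (ν=10⁻⁴)).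
Nearest prior art (searched this session, corpus + galaxy): Beck–Chaudhary–Wayne arXiv:1804.06916 §4.1.3 Prop. 4.13 (Villani functional
`ζ₀|u|² + Σζ_m|v_m|² + 2Re(iuΣσ_m v̄_m)` per streamwise wavenumber of a channel shear flow, ν-independent rate on `κ₀ ≤ |κ| ≤ κ₁/ν` — scalar,
no pressure); Bedrossian–Coti Zelati arXiv:1510.08098; Villani, Hypocoercivity (Mem. AMS 202, 2009) §I.4.  New here: the Leray-projected vector chain on a
Bloch lattice fibre with drain form `Q̂` = the `slotTerm` polarisation factor, the κ-free `ε` (uniform on `r ∈ [1/Kb, ∞)` incl. the `r²` Taylor scaling),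
the ramped-slot no-prefactor composition, and `doubleCoverage_sum`.
-/

set_option linter.dupNamespace false

namespace Summit.AnomalousDissipation.AnomalousDissipation.Cruxes.LagrangianRenormalisationStep.ThreeMode

/-- Right-hand sides of the real scalar chain `ẋ_j = −d_j x_j − l_{j−1,j} x_{j−1} + l_{j,j+1} x_{j+1}` at the five modes
`0, +1, −1, +2, −2` (`x0 xp xm xpp xmm`); `l1p = l_{0,1}`, `l1m = l_{−1,0}`, `l2p = l_{1,2}`, `l2m = l_{−2,−1}`;
the `±3` modes enter `ẋ_{±2}` only, which the functional never differentiates. -/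
def dx0 (d0 l1p l1m x0 xp xm : ℝ) : ℝ := -d0 * x0 + l1p * xp - l1m * xm
/-- `ẋ_{+1}`. -/
def dxp (d1p l1p l2p x0 xp xpp : ℝ) : ℝ := -d1p * xp - l1p * x0 + l2p * xpp
/-- `ẋ_{−1}`. -/
def dxm (d1m l1m l2m x0 xm xmm : ℝ) : ℝ := -d1m * xm + l1m * x0 - l2m * xmm

/-- The cross term `X = x_0 · b`, `b = l_{0,1} x_{+1} − l_{−1,0} x_{−1}` (`= ẋ_0 + d_0 x_0`). -/
def crossB (l1p l1m xp xm : ℝ) : ℝ := l1p * xp - l1m * xm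

/-- The polynomial `Ẋ` used in the certificate. -/
def xdot (d0 d1p d1m l1p l1m l2p l2m x0 xp xm xpp xmm : ℝ) : ℝ :=
  crossB l1p l1m xp xm ^ 2 - d0 * x0 * crossB l1p l1m xp xm - (l1p ^ 2 + l1m ^ 2) * x0 ^ 2
    - x0 * (l1p * d1p * xp - l1m * d1m * xm) + x0 * (l1p * l2p * xpp + l1m * l2m * xmm)

/-- `Ẋ = ẋ_0 · b + x_0 · ḃ` along the chain (so `xdot` IS the time derivative of `X`). -/
theorem xdot_identity (d0 d1p d1m l1p l1m l2p l2m x0 xp xm xpp xmm : ℝ) :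
    xdot d0 d1p d1m l1p l1m l2p l2m x0 xp xm xpp xmm =
      dx0 d0 l1p l1m x0 xp xm * crossB l1p l1m xp xm +
        x0 * (l1p * dxp d1p l1p l2p x0 xp xpp - l1m * dxm d1m l1m l2m x0 xm xmm) := by
  unfold xdot dx0 dxp dxm crossB; ring

/-- `b = ẋ_0 + d_0 x_0`: the cross term is `x_0 ẋ_0 + d_0 x_0² = ½ d(x_0²)/dt + d_0 x_0²`. -/
theorem crossB_eq (d0 l1p l1m x0 xp xm : ℝ) :
    crossB l1p l1m xp xm = dx0 d0 l1p l1m x0 xp xm + d0 * x0 := by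
  unfold crossB dx0; ring

/-- THE POINTWISE FORM INEQUALITY (heart of F-p4g13-1).  Energy part `−2 Σ d_j x_j²` over the five modes plus `ε·Ẋ` is bounded by
a negative form: slow drain `ε Λ²/2`, fast modes keep `3 d_min/2` resp. `d_2`.  Constraints: `εΛ² ≤ d_min/4`,
`ε (d_0 + d_{±1})² ≤ d_min/4`, `ε l_{±1,±2}² ≤ d_2`.  No sign assumption on the links. -/
theorem threeMode_form_le
    (d0 d1p d1m d2p d2m dmin dtwo eps l1p l1m l2p l2m x0 xp xm xpp xmm : ℝ)
    (hd0 : 0 ≤ d0) (hp : dmin ≤ d1p) (hm : dmin ≤ d1m) (hpp : dtwo ≤ d2p) (hmm : dtwo ≤ d2m)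
    (he : 0 ≤ eps)
    (c1 : eps * (l1p ^ 2 + l1m ^ 2) ≤ dmin / 4)
    (c2p : eps * (d0 + d1p) ^ 2 ≤ dmin / 4) (c2m : eps * (d0 + d1m) ^ 2 ≤ dmin / 4)
    (c3p : eps * l2p ^ 2 ≤ dtwo) (c3m : eps * l2m ^ 2 ≤ dtwo) :
    -2 * (d0 * x0 ^ 2 + d1p * xp ^ 2 + d1m * xm ^ 2 + d2p * xpp ^ 2 + d2m * xmm ^ 2)
        + eps * xdot d0 d1p d1m l1p l1m l2p l2m x0 xp xm xpp xmm ≤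
      -(eps * (l1p ^ 2 + l1m ^ 2) / 2) * x0 ^ 2 - (3 * dmin / 2) * (xp ^ 2 + xm ^ 2) - dtwo * (xpp ^ 2 + xmm ^ 2) := by
  unfold xdot crossB
  -- (Y1) Cauchy–Schwarz for b², then constraint c1
  have y1 : eps * (l1p * xp - l1m * xm) ^ 2 ≤ eps * ((l1p ^ 2 + l1m ^ 2) * (xp ^ 2 + xm ^ 2)) := by
    apply mul_le_mul_of_nonneg_left _ he
    nlinarith [sq_nonneg (l1p * xm + l1m * xp)]
  have y1' : eps * ((l1p ^ 2 + l1m ^ 2) * (xp ^ 2 + xm ^ 2)) ≤ dmin / 4 * (xp ^ 2 + xm ^ 2) := by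
    have := mul_le_mul_of_nonneg_right c1 (by positivity : (0:ℝ) ≤ xp ^ 2 + xm ^ 2)
    linarith [this]
  -- (Y2),(Y3) slow×fast damping cross terms, then c2p, c2m
  have y2 : 0 ≤ eps * (l1p * x0 / 2 + (d0 + d1p) * xp) ^ 2 := mul_nonneg he (sq_nonneg _)
  have y3 : 0 ≤ eps * (l1m * x0 / 2 - (d0 + d1m) * xm) ^ 2 := mul_nonneg he (sq_nonneg _)
  have y2' : eps * (d0 + d1p) ^ 2 * xp ^ 2 ≤ dmin / 4 * xp ^ 2 :=
    mul_le_mul_of_nonneg_right c2p (sq_nonneg _)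
  have y3' : eps * (d0 + d1m) ^ 2 * xm ^ 2 ≤ dmin / 4 * xm ^ 2 :=
    mul_le_mul_of_nonneg_right c2m (sq_nonneg _)
  -- (Y4),(Y5) slow×(±2) terms, then c3p, c3m
  have y4 : 0 ≤ eps * (l1p * x0 / 2 - l2p * xpp) ^ 2 := mul_nonneg he (sq_nonneg _)
  have y5 : 0 ≤ eps * (l1m * x0 / 2 - l2m * xmm) ^ 2 := mul_nonneg he (sq_nonneg _)
  have y4' : eps * l2p ^ 2 * xpp ^ 2 ≤ dtwo * xpp ^ 2 := mul_le_mul_of_nonneg_right c3p (sq_nonneg _)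
  have y5' : eps * l2m ^ 2 * xmm ^ 2 ≤ dtwo * xmm ^ 2 := mul_le_mul_of_nonneg_right c3m (sq_nonneg _)
  -- bare slack
  have s0 : 0 ≤ d0 * x0 ^ 2 := mul_nonneg hd0 (sq_nonneg _)
  have sp : dmin * xp ^ 2 ≤ d1p * xp ^ 2 := mul_le_mul_of_nonneg_right hp (sq_nonneg _)
  have sm : dmin * xm ^ 2 ≤ d1m * xm ^ 2 := mul_le_mul_of_nonneg_right hm (sq_nonneg _)
  have spp : dtwo * xpp ^ 2 ≤ d2p * xpp ^ 2 := mul_le_mul_of_nonneg_right hpp (sq_nonneg _)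
  have smm : dtwo * xmm ^ 2 ≤ d2m * xmm ^ 2 := mul_le_mul_of_nonneg_right hmm (sq_nonneg _)
  linarith [y1, y1', y2, y3, y2', y3', y4, y5, y4', y5', s0, sp, sm, spp, smm]

/-- NORM EQUIVALENCE of the functional: `2|ε X| ≤ εΛ'·(x_0² + x_{+1}² + x_{−1}²)` whenever `Λ'² ≥ l_{0,1}² + l_{−1,0}²`, `Λ' > 0`;
with `εΛ' ≤ 1/2` this is `¾ E ≤ Φ ≤ 5E/4`. -/
theorem threeMode_equiv (eps L l1p l1m x0 xp xm : ℝ) (he : 0 ≤ eps) (hL : 0 < L)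
    (hLl : l1p ^ 2 + l1m ^ 2 ≤ L ^ 2) :
    2 * |eps * (x0 * crossB l1p l1m xp xm)| ≤ eps * L * (x0 ^ 2 + xp ^ 2 + xm ^ 2) := by
  unfold crossB
  have key : 2 * |x0 * (l1p * xp - l1m * xm)| ≤ L * (x0 ^ 2 + xp ^ 2 + xm ^ 2) := by
    have cs : (l1p * xp - l1m * xm) ^ 2 ≤ L ^ 2 * (xp ^ 2 + xm ^ 2) := by
      nlinarith [sq_nonneg (l1p * xm + l1m * xp), sq_nonneg xp, sq_nonneg xm]
    rw [abs_mul]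
    set b := l1p * xp - l1m * xm with hb
    -- 2|x0||b| L ≤ L²x0² + b² ≤ L² (x0² + xp² + xm²), then divide by L
    have h1 : 2 * (L * |x0|) * |b| ≤ (L * |x0|) ^ 2 + |b| ^ 2 := two_mul_le_add_sq _ _
    have h2 : |b| ^ 2 = b ^ 2 := sq_abs b
    have h3 : (L * |x0|) ^ 2 = L ^ 2 * x0 ^ 2 := by rw [mul_pow, sq_abs]
    have h4 : L * (2 * |x0| * |b|) ≤ L * (L * (x0 ^ 2 + xp ^ 2 + xm ^ 2)) := by nlinarith [h1, h2, h3, cs]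
    have := le_of_mul_le_mul_left h4 hL
    linarith
  have := mul_le_mul_of_nonneg_left key he
  rw [abs_mul, abs_of_nonneg he]
  linarith [this]

/-- RAMP TERM.  With `l = a(t)·l̂`, `Ẋ` acquires `ȧ · x_0 · b̂` (`b̂ = l̂_{0,1} x_{+1} − l̂_{−1,0} x_{−1}`); Young:
`ε ȧ x_0 b̂ ≤ (ε² ȧ² Λ̂²/(2 d)) x_0² + (d/2)(x_{+1}² + x_{−1}²)` for any `d > 0`, `0 < Λ̂²`, `l̂_{0,1}² + l̂_{−1,0}² ≤ Λ̂²`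
(take `d = d_min`: the fast half is paid by fast dissipation, the slow cost is `ε²ȧ²Λ̂²/(2d_min)·x_0²`). -/
theorem ramp_term_le (eps adot d Lh l1p l1m x0 xp xm : ℝ) (hd : 0 < d) (hLh : 0 < Lh)
    (hL : l1p ^ 2 + l1m ^ 2 ≤ Lh) :
    eps * adot * (x0 * crossB l1p l1m xp xm) ≤
      eps ^ 2 * adot ^ 2 * Lh / (2 * d) * x0 ^ 2 + d / 2 * (xp ^ 2 + xm ^ 2) := by
  unfold crossB
  set b := l1p * xp - l1m * xm with hb
  have cs : b ^ 2 ≤ Lh * (xp ^ 2 + xm ^ 2) := by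
    rw [hb]; nlinarith [sq_nonneg (l1p * xm + l1m * xp), sq_nonneg xp, sq_nonneg xm]
  have hc : (0 : ℝ) < 2 * d * Lh := by positivity
  -- 2 d Λ̂² · (RHS − LHS) = (ε ȧ Λ̂² x0 − d b)² + d² (Λ̂² (x₊² + x₋²) − b²) ≥ 0
  have key : 2 * d * Lh * (eps ^ 2 * adot ^ 2 * Lh / (2 * d) * x0 ^ 2 + d / 2 * (xp ^ 2 + xm ^ 2))
      - 2 * d * Lh * (eps * adot * (x0 * b)) =
      (eps * adot * Lh * x0 - d * b) ^ 2 + d ^ 2 * (Lh * (xp ^ 2 + xm ^ 2) - b ^ 2) := by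
    field_simp
    ring
  have hnn : 0 ≤ (eps * adot * Lh * x0 - d * b) ^ 2 + d ^ 2 * (Lh * (xp ^ 2 + xm ^ 2) - b ^ 2) := by
    have : 0 ≤ Lh * (xp ^ 2 + xm ^ 2) - b ^ 2 := sub_nonneg.mpr cs
    positivity
  have h2 : 2 * d * Lh * (eps * adot * (x0 * b)) ≤
      2 * d * Lh * (eps ^ 2 * adot ^ 2 * Lh / (2 * d) * x0 ^ 2 + d / 2 * (xp ^ 2 + xm ^ 2)) := by
    linarith [key, hnn]
  exact le_of_mul_le_mul_left h2 hc

/-- NET SLOW DRAIN WITH RAMP (bookkeeping): gain `ε a² Λ̂²/2 · x_0²` minus ramp cost `ε² ȧ² Λ̂²/(2 d_min) · x_0²`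
is `(ε Λ̂²/2)(a² − ε ȧ²/d_min) x_0²` (pure algebra, recorded for the memo's formula). -/
theorem net_slow_drain (eps a adot Lh dmin x0 : ℝ) (hd : dmin ≠ 0) :
    eps * a ^ 2 * Lh / 2 * x0 ^ 2 - eps ^ 2 * adot ^ 2 * Lh / (2 * dmin) * x0 ^ 2 =
      eps * Lh / 2 * (a ^ 2 - eps * adot ^ 2 / dmin) * x0 ^ 2 := by
  field_simp

/-! ## Double coverage of the cubature word (the period step)

For fibre direction `q` the minimum over slow polarisations `p ⊥ q` of a slot's angular drain factor `(v̂·q̂)²(1 − (p·m̂)²)` is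
`(v̂·q̂)²(m̂·q̂)²`; summing the two polarisation slots of each of the 13 directions of `cubatureWord` (frame completeness
`(v·q)²/n + (v'·q)²/n' = |q|² − (m·q)²/|m|²`) and using the cubature moments gives the ISOTROPIC constant `56 |q|⁴ / |m|⁴`-weighted sum below. -/

open Summit.AnomalousDissipation.AnomalousDissipation.Theorems in
/-- Per-slot double-coverage term `τ (v·q)² (m·q)² / (n |m|⁶)` (slot weight `τ = c|m|⁴`, so this is `c (v̂·q)²(m̂·q)²·|q|⁰`). -/
noncomputable def dcTerm (d : SlotData) (q : EuclideanSpace ℝ (Fin 3)) : ℝ :=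
  (d.τ : ℝ) * ((d.v 0 : ℝ) * q 0 + d.v 1 * q 1 + d.v 2 * q 2) ^ 2 * ((d.m 0 : ℝ) * q 0 + d.m 1 * q 1 + d.m 2 * q 2) ^ 2 /
    (d.n * ((d.m 0 : ℝ) ^ 2 + d.m 1 ^ 2 + d.m 2 ^ 2) ^ 3)

open Summit.AnomalousDissipation.AnomalousDissipation.Theorems in
/-- DOUBLE COVERAGE: `Σ_{26 slots} τ (v·q)²(m·q)²/(n|m|⁶) = 56 |q|⁴` — every fibre direction has slots with BOTH `v̂·q̂ ≠ 0` and
`m̂·q̂ ≠ 0` (indeed `max_s (v̂_s·q̂)²(m̂_s·q̂)² ≥ 56/840 = 1/15` by pigeonhole, `Σ_s c_{m_s} = 2·(3·40 + 6·32 + 4·27) = 840`), so in every design period some slot drains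
the WHOLE slow plane of the fibre. (`= 140 − 84` from the second and fourth cubature moments.) -/
theorem doubleCoverage_sum (q : EuclideanSpace ℝ (Fin 3)) :
    ∑ j, dcTerm (slots j) q = 56 * (q 0 ^ 2 + q 1 ^ 2 + q 2 ^ 2) ^ 2 := by
  simp only [Fin.sum_univ_succ, Fin.sum_univ_zero, slots, dcTerm, Matrix.cons_val_zero, Matrix.cons_val_succ,
    Matrix.cons_val_one, Matrix.head_cons, Matrix.cons_val_two, Matrix.tail_cons]
  push_cast
  field_simp
  ring

end Summit.AnomalousDissipation.AnomalousDissipation.Cruxes.LagrangianRenormalisationStep.ThreeMode
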